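import Summits.HodgeConjecture.HodgeCM.Model.SupplyInstance_1

/-! PORT of `HodgeCM/Model/SupplyInstance.lean` (HodgeCMPerL run 82) — part 2: continuation of `Summits.HodgeConjecture.HodgeCM.Model.SupplyInstance_1` (split at a top-level declaration boundary by port_pkg.py; scope re-opened below; declarations unchanged). -/

-- port_pkg: scope re-opened for this part (file-level context, then the namespace/section stack open at the cut)
set_option autoImplicit false
noncomputable section
open MeasureTheory NumberField NumberField.mixedEmbedding IsDedekindDomain IsDedekindDomain.HeightOneSpectrum
open Literature.NumberTheory.Automorphic Literature.NumberTheory.Weil1964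
open HodgeCM.PerL34.Seesaw HodgeCM.PerL34.RationalCoset HodgeCM.PerL34.SupplyAdelic
open scoped SchwartzMap Classical
namespace HodgeCM
namespace Model
namespace SupplyInstance
section Bridge
variable (K L : Type) [Field K] [NumberField K] [Field L] [NumberField L] [Algebra K L] [FiniteDimensional K L]
variable (J : Type) [Fintype J] (GU : Type) [Group GU]
attribute [local instance] ratModule
namespace WeilLineData
variable {K L J GU} (D : WeilLineData K L J GU)
variable {U : Universe} (T : U.ThetaModel) {Lc : CMField} {ι₁ : Lc →+* ℂ} (V : HermSpace3 Lc ι₁) (c : SeesawCtx Lc)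
  (k : Fin 4)
variable {T V c k}
/-- **The gen-3 bridge record over the constructed carriers.** -/
def bridge (hres : D.Residual T V c k) : SupplyBridgeA T V c k where
  DS := D.seesawData
  rat := relNormOneRat K L
  ν := probHaarRelNormOneQuot K L
  B := relNormOneInfUnits K L
  i := relNormOneInfToIdeles K L
  w := D.w
  VK := J → K
  Vf := J → FiniteAdeleRing (𝓞 K) K
  ιf := finEmb K J
  Lhat := intLattice K J
  E := J → mixedSpace K
  LE := archLattice K J
  ι := archEmb K J
  hL := archEmb_mem_archLattice K J
  hinj := (archEmb_injective K J).injOn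
  f := D.Φinf
  x₀ := D.x₀
  hx₀ := D.hx₀
  φN := testFun K J D.Φinf D.x₀
  g₀ := 1
  eX := Equiv.refl _
  ev_phiN N hN ξ := testFun_ratPt K J D.Φinf D.x₀ hN ξ
  act_one φ := by
    show D.ω ((1 : GU), (1 : relNormOneIdeles K L)) φ = φ
    rw [Prod.mk_one_one, map_one, Module.End.one_apply]
  act_mul u v φ := by
    show D.ω ((1 : GU), u * v) φ = D.ω (1, u) (D.ω (1, v) φ)
    rw [show ((1 : GU), u * v) = ((1 : GU), u) * ((1 : GU), v) by rw [Prod.mk_mul_mk, one_mul], map_mul,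
      Module.End.mul_apply]
  act_smul u a φ := map_smul (D.ω ((1 : GU), u)) a φ
  ev_smul a φ ξ := rfl
  weight := D.weight
  cont := D.continuous_kernel
  inv := D.kernel_rat_mul
  form_of_lift := hres

/-- The bridge's theta kernel is the tree's theta distribution. -/
theorem bridge_theta (hres : D.Residual T V c k) (N : ℕ) (u : relNormOneIdeles K L) :
    (D.bridge hres).theta N u = thetaDistLM K J (D.ω (1, u) (testFun K J D.Φinf D.x₀ N)) := rfl

/-- **Supply of type index `k` over the constructed carriers**, KERNEL modulo (W-wt), (W-maj), (W-rat), (W-res):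
route (E) (`SupplyBridgeA.supply_of_bridgeA`: lattice sums + character separation on the compact torus) applied to
the instantiated record. -/
theorem supply (hres : D.Residual T V c k) : ∃ Γ : Level V, ∃ ω ∈ T.Theta V c k Γ, ω ≠ 0 :=
  (D.bridge hres).supply_of_bridgeA

end WeilLineData

end Bridge

/-! ### § 5. `Open_supply` from line data in every good context -/

section OpenSupply

variable {U : Universe} (T : U.ThetaModel)

/-- The supply datum for type index `k` in a context: base field `K = L₀`, CM extension `L`, index type `J` of a
Lagrangian basis, the group `G_U(𝔸)`, the line data and its residual. -/
structure LineSupplyData {Lc : CMField} {ι₁ : Lc →+* ℂ} (V : HermSpace3 Lc ι₁) (c : SeesawCtx Lc) (k : Fin 4) :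
    Type 1 where
  K : Type
  L : Type
  [instK : Field K]
  [instKn : NumberField K]
  [instL : Field L]
  [instLn : NumberField L]
  [instA : Algebra K L]
  [instFD : FiniteDimensional K L]
  J : Type
  [instJ : Fintype J]
  GU : Type
  [instGU : Group GU]
  D : WeilLineData K L J GU
  res : D.Residual T V c k

attribute [instance] LineSupplyData.instK LineSupplyData.instKn LineSupplyData.instL LineSupplyData.instLn
  LineSupplyData.instA LineSupplyData.instFD LineSupplyData.instJ LineSupplyData.instGU

/-- **`Open_supply` BY NAME** (prover 1's `ThetaModel.Open_supply`, input C4 `thetaWedge` of the § 10 assembly) from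
line supply data of type indices `0` and `1` in every good context. -/
theorem open_supply_of_lineSupplyData
    (h : ∀ {Lc : CMField} {ι₁ : Lc →+* ℂ} (V : HermSpace3 Lc ι₁) (c : SeesawCtx Lc), T.GoodCtx ι₁ c →
      Nonempty (LineSupplyData T V c 0) ∧ Nonempty (LineSupplyData T V c 1)) :
    T.Open_supply :=
  open_supply_of_bridgesA T fun V c hc => by
    obtain ⟨⟨S₀⟩, ⟨S₁⟩⟩ := h V c hc
    exact ⟨⟨S₀.D.bridge S₀.res⟩, ⟨S₁.D.bridge S₁.res⟩⟩

end OpenSupply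

end SupplyInstance
end Model
end HodgeCM

end
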